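import Summits.KontsevichZagierPeriods.KontsevichZagierPeriods.Theorems.LinRedNormalFormArrangementNormalFormStubRebaseSimpleZeroNestedPinch
import Summits.KontsevichZagierPeriods.KontsevichZagierPeriods.Theorems.LinRedNormalFormArrangementNormalFormStubRebaseSimpleZeroNestedGrid

/-!
# Stub `stub_rebaseSimpleZeroTwo`, part `rebaseSimpleZero_nestedCommon` (crux `ArrangementNormalForm`,
line `janus-bands`) — brick `NestedDissect`

**The dissection of the base interval** of a clean nested pair `A(y) < tᵢ < tⱼ < B(y)` with
constant letters and a simple base pole (`RebaseNest.IsNest`), given the pinch-vertex blow-up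
move as the hypothesis `RebaseNest.BlowUp` (`IsNest.good_of_blowUp`):
* parallel bounds (`A' = B'`): empty fibres or a THICK pair (`IsNest.good_thick`, explicit grid
  of separable pieces);
* otherwise the bounds meet at the rational pinch point `y₀ = (A₀ − B₀)/(B' − A')`; cut the base
  at `y₀` and at `y₀ ± ε` (rule 1a, `IsNest.rowSplit`) with the explicit `ε` of
  `RebaseNest.pinch_side` on each side: the two near pieces are good by `pinch_side`, the two far
  pieces have empty fibres or are thick (`B − A = (B' − A')(y − y₀)` keeps a sign and is bounded
  below by `|B' − A'| ε` there).
Then `RebaseNest.good_cleanNest`: a clean nest with letters of a COMMON `y`-slope `λ` (literal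
`GS 0 2` datum) is good for `GG 0 2 2` — joint shear `RebaseNest.shear`, then the dissection.
Registered: `rebaseSimpleZero_nestedClean`.

References: M. Kontsevich, D. Zagier, *Periods* (2001), §1.2, rules (1a), (2).
-/

noncomputable section

open Set MeasureTheory MvPolynomial
open Literature.NumberTheory.Transcendental Literature.ModelTheory.ExponentialFields

namespace Summit.KontsevichZagierPeriods.ArrangementNormalForm.JanusBands

namespace RebaseNest

open SeparatePos RebasePos RebaseZero

variable {m' : ℕ} {s : KZ.IntegralRep (0 + 1 + 2)} {M : Fin m' → Cf} {i j : Fin 2} {A Bd : Cf} {T : BData}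
  {p : MvPolynomial (Fin 0) ℚ} {a : Fin 2 → Option Cf}

/-- Membership in the base cell with two more rows. [folklore] -/
theorem mem_cell_snoc_snoc (M : Fin m' → Cf) (q q' : Cf) (y : ℝ) :
    y ∈ cell (Fin.snoc (Fin.snoc M q : Fin (m' + 1) → Cf) q' : Fin (m' + 2) → Cf) ↔
      y ∈ cell M ∧ 0 < ev q y ∧ 0 < ev q' y := by
  rw [mem_cell_snoc, mem_cell_snoc, and_assoc]

/-- **The dissection of the base interval.** A clean nested pair over a one-dimensional base
with constant letters and a simple base pole is good for `GG 0 2 2`, given the pinch-vertex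
blow-up move (`RebaseNest.BlowUp`). [Kontsevich–Zagier 2001, §1.2, rules (1), (2)] -/
theorem IsNest.good_of_blowUp (hB : BlowUp) (hN : IsNest s M i j A Bd T p a) : Good 2 (KZ.of s) := by
  by_cases hαβ : A.1 (Fin.last 0) = Bd.1 (Fin.last 0)
  · -- parallel bounds
    have hD : ∀ y : ℝ, ev Bd y - ev A y = ((Bd.2 - A.2 : ℚ) : ℝ) := fun y => by
      have : (A.1 (Fin.last 0) : ℝ) = Bd.1 (Fin.last 0) := by exact_mod_cast hαβ
      simp only [ev, Rat.cast_sub, this]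
      ring
    by_cases hd : Bd.2 - A.2 ≤ 0
    · refine hN.good_empty fun y _ => ?_
      have h0 : ((Bd.2 - A.2 : ℚ) : ℝ) ≤ 0 := by exact_mod_cast hd
      linarith [hD y]
    · exact hN.good_thick (Bd.2 - A.2) (not_le.1 hd) fun y _ => (hD y).ge
  -- the pinch point
  have hne : Bd.1 (Fin.last 0) - A.1 (Fin.last 0) ≠ 0 := sub_ne_zero.2 (Ne.symm hαβ)
  set y₀ : ℚ := (A.2 - Bd.2) / (Bd.1 (Fin.last 0) - A.1 (Fin.last 0)) with hy₀
  set t₀ : ℚ := A.1 (Fin.last 0) * y₀ + A.2 with ht₀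
  have hA0 : A.1 (Fin.last 0) * y₀ + A.2 = t₀ := rfl
  have hB0 : Bd.1 (Fin.last 0) * y₀ + Bd.2 = t₀ := by
    have : (Bd.1 (Fin.last 0) - A.1 (Fin.last 0)) * y₀ = A.2 - Bd.2 := by
      rw [hy₀]; field_simp
    rw [ht₀]; linarith
  have hD : ∀ y : ℝ, ev Bd y - ev A y = ((Bd.1 (Fin.last 0) : ℝ) - A.1 (Fin.last 0)) * (y - y₀) :=
    ev_sub_vertex hA0 hB0
  -- the explicit caps on both sides
  obtain ⟨εR, hεR, hgoodR⟩ := pinch_side (ε₁ := 1) hN.ne T a (Or.inl rfl) hA0 hB0 hB M (RebaseZero.mk 1 (-y₀))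
    fun y => by rw [ev_mk]; push_cast; ring
  obtain ⟨εL, hεL, hgoodL⟩ := pinch_side (ε₁ := -1) hN.ne T a (Or.inr rfl) hA0 hB0 hB M (-RebaseZero.mk 1 (-y₀))
    fun y => by rw [ev_neg, ev_mk]; push_cast; ring
  have hεR' : (0 : ℝ) < εR := by exact_mod_cast hεR
  have hεL' : (0 : ℝ) < εL := by exact_mod_cast hεL
  refine hN.rowSplit (RebaseZero.mk 1 (-y₀)) (mk_ne_zero one_ne_zero _) (fun s₁ h₁ => ?_) (fun s₂ h₂ => ?_)
  · -- the right side `y > y₀`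
    refine h₁.rowSplit (RebaseZero.mk (-1) (1 * y₀ + εR)) (mk_ne_zero (by norm_num) _)
      (fun s₃ h₃ => hgoodR s₃ p h₃) fun s₄ h₄ => ?_
    -- the far piece `y > y₀ + εR`
    have hfar : ∀ y ∈ cell (Fin.snoc (Fin.snoc M (RebaseZero.mk 1 (-y₀)) : Fin (m' + 1) → Cf)
        (-RebaseZero.mk (-1) (1 * y₀ + εR)) : Fin (m' + 2) → Cf), (εR : ℝ) < y - y₀ := fun y hy => by
      rw [mem_cell_snoc_snoc] at hy
      obtain ⟨-, -, h2⟩ := hy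
      rw [ev_neg, ev_mk] at h2
      push_cast at h2
      linarith
    rcases lt_or_gt_of_ne hαβ with hlt | hgt
    · refine h₄.good_thick ((Bd.1 (Fin.last 0) - A.1 (Fin.last 0)) * εR) (mul_pos (sub_pos.2 hlt) hεR)
        fun y hy => ?_
      have hlt' : (A.1 (Fin.last 0) : ℝ) < Bd.1 (Fin.last 0) := by exact_mod_cast hlt
      rw [hD y, Rat.cast_mul, Rat.cast_sub]
      nlinarith [hfar y hy]
    · refine h₄.good_empty fun y hy => ?_
      have hgt' : (Bd.1 (Fin.last 0) : ℝ) < A.1 (Fin.last 0) := by exact_mod_cast hgt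
      nlinarith [hfar y hy, hD y]
  · -- the left side `y < y₀`
    refine h₂.rowSplit (RebaseZero.mk (-(-1)) (-1 * y₀ + εL)) (mk_ne_zero (by norm_num) _)
      (fun s₃ h₃ => hgoodL s₃ p h₃) fun s₄ h₄ => ?_
    -- the far piece `y < y₀ - εL`
    have hfar : ∀ y ∈ cell (Fin.snoc (Fin.snoc M (-RebaseZero.mk 1 (-y₀)) : Fin (m' + 1) → Cf)
        (-RebaseZero.mk (-(-1)) (-1 * y₀ + εL)) : Fin (m' + 2) → Cf), (εL : ℝ) < y₀ - y := fun y hy => by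
      rw [mem_cell_snoc_snoc] at hy
      obtain ⟨-, -, h2⟩ := hy
      rw [ev_neg, ev_mk] at h2
      push_cast at h2
      linarith
    rcases lt_or_gt_of_ne hαβ with hlt | hgt
    · refine h₄.good_empty fun y hy => ?_
      have hlt' : (A.1 (Fin.last 0) : ℝ) < Bd.1 (Fin.last 0) := by exact_mod_cast hlt
      nlinarith [hfar y hy, hD y]
    · refine h₄.good_thick ((A.1 (Fin.last 0) - Bd.1 (Fin.last 0)) * εL) (mul_pos (sub_pos.2 hgt) hεL)
        fun y hy => ?_
      have hgt' : (Bd.1 (Fin.last 0) : ℝ) < A.1 (Fin.last 0) := by exact_mod_cast hgt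
      rw [hD y, Rat.cast_mul, Rat.cast_sub]
      nlinarith [hfar y hy]

/-- **Clean nests with letters of a common `y`-slope are good.** A representation with a literal
`GS 0 2` datum (simple base pole: `n₁ = 0`, `n₂ = 1`) whose two fibres form the clean nest
`A < tᵢ < tⱼ < B` and whose letters have the common `y`-slope `λ` is good for `GG 0 2 2`, given
the pinch-vertex blow-up move: joint shear along `λ` (`RebaseNest.shear`), then the dissection
of the base interval (`IsNest.good_of_blowUp`). [Kontsevich–Zagier 2001, §1.2, rules (1), (2)] -/
theorem good_cleanNest (hB : BlowUp) {m n₁ n₂ : ℕ} (s : KZ.IntegralRep (0 + 1 + 2)) (M : Fin m' → Cf)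
    (L : Fin m → (Fin 0 → ℚ) × ℚ) (e : Fin m → ℕ) (p : MvPolynomial (Fin 0) ℚ) (ℓ₁ ℓ₂ : (Fin 0 → ℚ) × ℚ)
    (a : Fin 2 → Option Cf) (lo hi : Fin 2 → Fin 2 ⊕ Cf) (hij : i ≠ j) (A Bd : Cf) (h1 : n₁ = 0) (hn : n₂ = 1)
    (hbd : Bornology.IsBounded s.domain) (hdom : s.domain = gDom 0 2 m' M lo hi)
    (hint : EqOn s.integrand (glit 0 2 p L e ℓ₁ ℓ₂ n₁ n₂ a) s.domain)
    (hloi : lo i = Sum.inr A) (hhii : hi i = Sum.inl j) (hloj : lo j = Sum.inl i) (hhij : hi j = Sum.inr Bd)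
    (lam : ℚ) (ha : ∀ l c, a l = some c → c.1 (Fin.last 0) = lam) :
    Good 2 (KZ.of s) := by
  obtain ⟨hlo, hhi⟩ := eq_nlo_nhi hij hloi hhii hloj hhij
  subst hlo hhi
  obtain ⟨s', hN, hrel⟩ := shear s M L e p ℓ₁ ℓ₂ a hij A Bd h1 hn hbd hdom hint lam ha
  exact good_of_sub_mem hrel (hN.good_of_blowUp hB)

end RebaseNest

/-- Registered support goal of this file (part of `rebaseSimpleZero_nestedCommon`): clean nested
pairs with letters of a common `y`-slope over a one-dimensional base are good for `GG 0 2 2`,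
given the pinch-vertex blow-up move (`RebaseNest.good_cleanNest`). -/
theorem rebaseSimpleZero_nestedClean (hB : RebaseNest.BlowUp) (m m' n₁ n₂ : ℕ) (s : KZ.IntegralRep (0 + 1 + 2)) (M : Fin m' → (Fin (0 + 1) → ℚ) × ℚ) (L : Fin m → (Fin 0 → ℚ) × ℚ) (e : Fin m → ℕ) (p : MvPolynomial (Fin 0) ℚ) (ℓ₁ ℓ₂ : (Fin 0 → ℚ) × ℚ) (a : Fin 2 → Option ((Fin (0 + 1) → ℚ) × ℚ)) (lo hi : Fin 2 → Fin 2 ⊕ ((Fin (0 + 1) → ℚ) × ℚ)) (i j : Fin 2) (hij : i ≠ j) (A Bd : (Fin (0 + 1) → ℚ) × ℚ) (h1 : n₁ = 0) (hn : n₂ = 1) (hbd : Bornology.IsBounded s.domain) (hdom : s.domain = SeparatePos.gDom 0 2 m' M lo hi) (hint : EqOn s.integrand (RebasePos.glit 0 2 p L e ℓ₁ ℓ₂ n₁ n₂ a) s.domain) (hloi : lo i = Sum.inr A) (hhii : hi i = Sum.inl j) (hloj : lo j = Sum.inl i) (hhij : hi j = Sum.inr Bd) (lam : ℚ) (ha :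 ∀ l c, a l = some c → c.1 (Fin.last 0) = lam) : RebaseZero.Good 2 (KZ.of s) :=
  RebaseNest.good_cleanNest hB s M L e p ℓ₁ ℓ₂ a lo hi hij A Bd h1 hn hbd hdom hint hloi hhii hloj hhij lam ha

end Summit.KontsevichZagierPeriods.ArrangementNormalForm.JanusBands
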